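import Summits.QuantumFields.YangMills.Theorems.BalabanUVNodesN22W1RelCentredOlderBlockOfReading
import Literature.MathematicalPhysics.QuantumFieldTheory.Balaban1983to89.Node00.HistoryTermDatum214OlderReadingComplex

/-!
# BalabanUVNodes ∕ node N22 = NE9 — THE RELATIVE-DISC CENTRED ROAD OVER THE ADMISSIBLE CLASS, MODULE J20: THE OLDER-TERMS HALF OF `SliceInputsL2U` — LEMMA 2's SENTENCE AND THE FOUR
# QUALITATIVE LAWS, ALL EIGHT FIELDS — READ OFF ONE COMPLEXIFIED (1.33)∕(1.41) READING BY NAME (node00-def-W1 W1-17c `ReadingAtomsC` ∕ `ReadsOnByC`; module J15's twin and completion)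

Cell `pub-ymgap`, HUMAN RULING D-0062 (Track A), R134 ACCELERATION re-seat `pub-ymgap-dag-n22-c` (strategy s1), generation 10, file J20.  THEOREMS ONLY; imports J15
`…OlderBlockOfReading` (`SliceInputsLGU.olderLaws_of_readsOnBy`: the four qualitative laws from a REAL reading) and node00-def-W1 W1-17c `Node00/HistoryTermDatum214OlderReadingComplex`
(`TermDatum214.ReadingAtomsC`: complex-field configuration families `cfgC`, `toReal`, `potentialC`, the laws `MapsToTablesC ∕ CfgFieldHoloOn ∕ CfgCHoloOn ∕ CfgCContinuous ∕
CfgCJointContinuous ∕ KernelBounded ∕ FiniteMass ∕ FiniteMassAt ∕ LocalInC` with their `toReal` bridges, the letter `crudeBound`, the schema `ReadsOnByC` with the transfer faces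
`ReadsOnByC.differentiableOn_field ∕ norm_le_at ∕ realSlice ∕ mono`; typed on this seat's ASK W1-17c, 2026-08-27) BY NAME.  `--supports` K3⁷ `SpineGivenEndpointR13SepCoPH`
(stmt-QuantumFields-20544) as a helper.

WHY.  Module J17-D `SliceInputsL2U` asks of the older-terms potential `𝒪(old, ξ; Y, ·)` of the unscaled-field law EIGHT things: Lemma 2's sentence per admissible history and
configuration — a complex extension `Oc Z t old ξ Y` on the sup-ball with the real-slice identity (`h𝒪re`), analyticity (`hOd`), a sup bound UNIFORM on the thickening and on the class
(`hOM`) with a signed letter (`hM𝒪`) — and the qualitative laws `h𝒪m h𝒪d hloc𝒪 hOhol`.  Print's (1.33)∕(1.41) reading `𝒪 = Σ_{j,X} ∫ K·E^{(j)}(X; cfg(ξ, A, s)) dμ` has configuration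
families ENTIRE in the field ([I] (3.10) p. 272: `U′ = exp(iξA)U_{k+1}`), so ONE complex reading carries all eight: THIS FILE reads them off W1-17c's `ReadsOnByC Oc Z t R (AdmHist …) W univ`.
* §1 `SliceInputsL2U.olderLemma2_of_readsOnByC` — the four Lemma-2 fields in J17-D's binder shapes at `𝒪 := 𝔇.realSliceOlder Oc`, `RA`, `M𝒪 := crudeBound C E₀ κ_E m` (kernel bound ×
  (1.18) × PER-ATOM masses — the localisation of (1.36) in `d(Y)` lives in the masses the producer supplies): `hM𝒪` (`crudeBound_nonneg`), `h𝒪re` (`rfl`), `hOd`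
  (`ReadsOnByC.differentiableOn_field` on `ball 0 RA`), `hOM` (`ReadsOnByC.norm_le_at`).
* §2 ★ `SliceInputsL2U.olderBlock_of_readsOnByC` — ALL EIGHT at once: §1 ∧ module J15's four for the real slice (`ReadsOnByC.realSlice` + the `toReal` bridges feed
  `SliceInputsLGU.olderLaws_of_readsOnBy` VERBATIM).  §3 the same for the READ PAIR `𝒪 := readOlder (toReal ∘ Rc)`, `Oc := readOlderC Rc` (`readsOnByC_readOlderC`).

HONEST FRAMING.  Count-neutral transfer (projections of W1-17c's faces; the one piece of mathematics — holomorphy under the integral sign in the complex field — is W1-17c's, cited);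
nothing of Bałaban's asserted: the complex reading OF RECORD with its laws at the datum of record (the (1.41)–(1.43) interpolation × Cauchy atoms of the terms of record, their masses,
the radius `RA = a₁e^{−16κ₁}`) is NODE A's ∕ def-B13's; no (1.36)∕(1.42) estimate claimed — `M𝒪`'s decay is only the masses'; the Wilson half of Lemma 2's sentence (`Wc hWd hWM hWB`,
[I] (2.8), (1.39)) is N09's and untouched; N22 NOT discharged (typed 28∕28 · discharged 5∕27 UNCHANGED); one finite four-torus programme at fixed ε — NOT infinite volume, NOT OS on
ℝ⁴, NOT a mass gap, NOT Clay.  0 `sorry`, 0 `def`, standard axioms.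

References (TYPES ∕ loci only): [II] = [Balaban1988RG2Cluster] Lemma 1 (1.33)–(1.36) p. 9, Lemma 2 (1.41)–(1.43) p. 11, (2.2)–(2.3) p. 12, (2.14) p. 15 ll. 19–20; [I] =
[Balaban1987RG1] §1 p. 263 with (1.18), (3.4) p. 270, (3.10) p. 272, (3.15)–(3.18) p. 273.
-/

noncomputable section

namespace YMDAG.N22.W1

open Set Metric
open scoped BigOperators
open Literature.MathematicalPhysics.QuantumFieldTheory.Balaban1983to89
open Literature.MathematicalPhysics.QuantumFieldTheory.Balaban1983to89.TreeLengthTorus (TPt TDom tsys torusTreeLen)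
open Literature.MathematicalPhysics.QuantumFieldTheory.Balaban1983to89.Step (SFConsts)
open Literature.MathematicalPhysics.QuantumFieldTheory.Balaban1983to89.Node00.Sect2 (domSys domCount CPair spaceI domSites Setting Residual)
open Literature.MathematicalPhysics.QuantumFieldTheory.Balaban1983to89.Node00.W1
open Literature.MathematicalPhysics.QuantumFieldTheory.Balaban1983to89.B13Lemma2LeadingParts (ofRealVec)

namespace SliceInputsL2U

variable {c₀ : B13.Consts} {P : Params} {𝔸 : Type*} [NormedRing 𝔸] [NormedAlgebra ℂ 𝔸] [CompleteSpace 𝔸] {M k L : ℕ} [NeZero L]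
  {𝔇 : TermDatum214 c₀ P 𝔸 M k L}
  {G : Type*} [GaugeGroup G] (Sg : Setting 𝔸 G) (Rz : Residual P 𝔸) (cs : SFConsts) (E₀ κE : ℝ)
  (Z : (domSys P M (k + 1)).Dom) (t : TermLabel P M k L) {W : Set (CPair P 𝔸)}
  {S : Type*} [MeasurableSpace S] [TopologicalSpace S] [OpensMeasurableSpace S] {R : 𝔇.ReadingAtomsC Z t S} {C mu RA : ℝ}
  {m : TDom P.d (L * domCount P M (k + 1)) → (j : Fin (k + 1)) → (domSys P M j).Dom → ℝ} {S₀ : Set (𝔇.𝒦 Z t).Λ}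
  (Oc : 𝔇.ComplexOlder)

/-! ## §1 The four Lemma-2 fields of the older terms from a complex reading on the sup-ball -/

/-- **THE OLDER-TERMS HALF OF LEMMA 2's SENTENCE IN `SliceInputsL2U`, FROM A COMPLEX READING** (J17-D's `hM𝒪 ∧ h𝒪re ∧ hOd ∧ hOM` at `𝒪 := realSliceOlder Oc`, radius `RA`, letter
`M𝒪 := crudeBound C E₀ κ_E m`): for an opaque complex potential `Oc` READ BY a complex reading `R` on the admissible class of the space tables of record, the thickening `W` and the
complex fields of `ball 0 RA` (W1-17c `ReadsOnByC`), whose families land in the tables and are analytic in the field there, continuous in the parameter, with kernels bounded by `C ≥ 0`,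
finite measures of per-atom masses `m ≥ 0`, and `E₀ ≥ 0` — one W1-17c face each (`crudeBound_nonneg`, `rfl`, `differentiableOn_field`, `norm_le_at`).
[cite: Balaban1988RG2Cluster, (1.34)-(1.36) p.9 and Lemma 2 (1.41)-(1.42) p.11; Balaban1987RG1, §1 p.263 with (1.18), (3.10) p.272 and (3.15)-(3.18) p.273] -/
theorem olderLemma2_of_readsOnByC
    (h : 𝔇.ReadsOnByC Oc Z t R (AdmHist (spaceOfRecord (M := M) Sg Rz (fun _ => cs.α₀) (fun _ => cs.α₁)) E₀ κE k) W (ball 0 RA))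
    (hmaps : R.MapsToTablesC (spaceOfRecord (M := M) Sg Rz (fun _ => cs.α₀) (fun _ => cs.α₁)) W (ball 0 RA)) (hhol : R.CfgFieldHoloOn W (ball 0 RA))
    (hcont : R.CfgCContinuous) (hC : 0 ≤ C) (hE₀ : 0 ≤ E₀) (hK : R.KernelBounded C) (hμ : R.FiniteMass mu) (hm : ∀ Y j X, 0 ≤ m Y j X) (hμm : R.FiniteMassAt m) :
    (∀ Y ∈ t.1, 0 ≤ TermDatum214.crudeBound C E₀ κE m Y) ∧
    (∀ old : OlderTerms P 𝔸 M k, old ∈ AdmHist (spaceOfRecord (M := M) Sg Rz (fun _ => cs.α₀) (fun _ => cs.α₁)) E₀ κE k → ∀ ξ ∈ W,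
      ∀ (Y : TDom P.d (L * domCount P M (k + 1))) (A : (𝔇.𝒦 Z t).Λ → ℝ), 𝔇.realSliceOlder Oc Z t old ξ Y A = Oc Z t old ξ Y (ofRealVec A)) ∧
    (∀ old : OlderTerms P 𝔸 M k, old ∈ AdmHist (spaceOfRecord (M := M) Sg Rz (fun _ => cs.α₀) (fun _ => cs.α₁)) E₀ κE k → ∀ ξ ∈ W,
      ∀ Y : TDom P.d (L * domCount P M (k + 1)), DifferentiableOn ℂ (Oc Z t old ξ Y) (ball 0 RA)) ∧
    (∀ old : OlderTerms P 𝔸 M k, old ∈ AdmHist (spaceOfRecord (M := M) Sg Rz (fun _ => cs.α₀) (fun _ => cs.α₁)) E₀ κE k → ∀ ξ ∈ W,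
      ∀ Y : TDom P.d (L * domCount P M (k + 1)), ∀ z ∈ ball (0 : (𝔇.𝒦 Z t).Λ → ℂ) RA, ‖Oc Z t old ξ Y z‖ ≤ TermDatum214.crudeBound C E₀ κE m Y) :=
  ⟨fun Y _ => TermDatum214.crudeBound_nonneg hC hE₀ hm Y,
    fun _ _ _ _ _ _ => rfl,
    fun _ hold _ hξ Y => h.differentiableOn_field isOpen_ball hmaps hhol hcont hK hμ hold hξ Y,
    fun _ hold _ hξ Y _ hz => h.norm_le_at hC hE₀ hmaps hK hμm hold hξ Y hz⟩

/-! ## §2 All eight older-terms fields of `SliceInputsL2U` from ONE complex reading read on every complex field -/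

/-- **★ THE OLDER-TERMS BLOCK OF `SliceInputsL2U`, ALL EIGHT FIELDS, FROM ONE COMPLEX READING** read on the admissible class, an OPEN thickening `W` and EVERY complex field
(`ReadsOnByC … W univ` — the clamped producer), whose families land in the tables, move analytically with the configuration and with the field, jointly continuously in (field,
parameter), with bounded kernels, finite measures (per-atom masses `m ≥ 0`), reading the field only in `S₀`: with `𝒪 := realSliceOlder Oc` and `M𝒪 := crudeBound C E₀ κ_E m`, the
four Lemma-2 fields of §1 on `ball 0 RA` (`ReadsOnByC.mono`) AND module J15's four qualitative laws `h𝒪m ∧ h𝒪d ∧ hloc𝒪 ∧ hOhol` for the real slice (`ReadsOnByC.realSlice` + the `toReal`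
bridges into `SliceInputsLGU.olderLaws_of_readsOnBy`).  The producer of record supplies ONE `ReadingAtomsC` with its laws; nothing else of the older-terms block remains.
[cite: Balaban1988RG2Cluster, Lemma 1 (1.33)-(1.36) p.9, Lemma 2 (1.41)-(1.42) p.11, (2.2)-(2.3) p.12 and (2.14) p.15 ll.19-20; Balaban1987RG1, §1 p.263, (3.4) p.270, (3.10) p.272 and (3.15)-(3.18) p.273] -/
theorem olderBlock_of_readsOnByC
    (h : 𝔇.ReadsOnByC Oc Z t R (AdmHist (spaceOfRecord (M := M) Sg Rz (fun _ => cs.α₀) (fun _ => cs.α₁)) E₀ κE k) W univ) (hW : IsOpen W)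
    (hmaps : R.MapsToTablesC (fun j X => spaceI Sg Rz M j (domSites P M j X) cs.α₀ cs.α₁) W univ) (hholξ : R.CfgCHoloOn W univ) (hhol : R.CfgFieldHoloOn W univ)
    (hjc : R.CfgCJointContinuous) (hC : 0 ≤ C) (hE₀ : 0 ≤ E₀) (hK : R.KernelBounded C) (hμ : R.FiniteMass mu) (hm : ∀ Y j X, 0 ≤ m Y j X) (hμm : R.FiniteMassAt m)
    (hloc : R.LocalInC S₀) :
    ((∀ Y ∈ t.1, 0 ≤ TermDatum214.crudeBound C E₀ κE m Y) ∧
      (∀ old : OlderTerms P 𝔸 M k, old ∈ AdmHist (spaceOfRecord (M := M) Sg Rz (fun _ => cs.α₀) (fun _ => cs.α₁)) E₀ κE k → ∀ ξ ∈ W,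
        ∀ (Y : TDom P.d (L * domCount P M (k + 1))) (A : (𝔇.𝒦 Z t).Λ → ℝ), 𝔇.realSliceOlder Oc Z t old ξ Y A = Oc Z t old ξ Y (ofRealVec A)) ∧
      (∀ old : OlderTerms P 𝔸 M k, old ∈ AdmHist (spaceOfRecord (M := M) Sg Rz (fun _ => cs.α₀) (fun _ => cs.α₁)) E₀ κE k → ∀ ξ ∈ W,
        ∀ Y : TDom P.d (L * domCount P M (k + 1)), DifferentiableOn ℂ (Oc Z t old ξ Y) (ball 0 RA)) ∧
      (∀ old : OlderTerms P 𝔸 M k, old ∈ AdmHist (spaceOfRecord (M := M) Sg Rz (fun _ => cs.α₀) (fun _ => cs.α₁)) E₀ κE k → ∀ ξ ∈ W,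
        ∀ Y : TDom P.d (L * domCount P M (k + 1)), ∀ z ∈ ball (0 : (𝔇.𝒦 Z t).Λ → ℂ) RA, ‖Oc Z t old ξ Y z‖ ≤ TermDatum214.crudeBound C E₀ κE m Y)) ∧
    ((∀ old : OlderTerms P 𝔸 M k, old ∈ AdmHist (spaceOfRecord (M := M) Sg Rz (fun _ => cs.α₀) (fun _ => cs.α₁)) E₀ κE k →
        ∀ ξ ∈ W, ∀ Y : TDom P.d (L * domCount P M (k + 1)), Measurable (𝔇.realSliceOlder Oc Z t old ξ Y)) ∧
      (∀ old : OlderTerms P 𝔸 M k, old ∈ AdmHist (spaceOfRecord (M := M) Sg Rz (fun _ => cs.α₀) (fun _ => cs.α₁)) E₀ κE k →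
        ∀ (Y : TDom P.d (L * domCount P M (k + 1))) (A : (𝔇.𝒦 Z t).Λ → ℝ), DifferentiableOn ℂ (fun ξ : CPair P 𝔸 => 𝔇.realSliceOlder Oc Z t old ξ Y A) W) ∧
      (∀ old : OlderTerms P 𝔸 M k, old ∈ AdmHist (spaceOfRecord (M := M) Sg Rz (fun _ => cs.α₀) (fun _ => cs.α₁)) E₀ κE k →
        ∀ ξ ∈ W, ∀ Y ∈ t.1, ∀ A A' : (𝔇.𝒦 Z t).Λ → ℝ, (∀ b ∈ S₀, A b = A' b) → 𝔇.realSliceOlder Oc Z t old ξ Y A = 𝔇.realSliceOlder Oc Z t old ξ Y A') ∧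
      (∀ ξ ∈ W, ∀ (O : Set ℂ), IsOpen O → ∀ cv : ℂ → OlderTerms P 𝔸 M k,
        (∀ (j : Fin (k + 1)) (Y : (domSys P M j).Dom) (ψ : CPair P 𝔸), ψ ∈ spaceI Sg Rz M j (domSites P M j Y) cs.α₀ cs.α₁ →
          DifferentiableOn ℂ (fun z => cv z j Y ψ) O ∧ ∀ z ∈ O, ‖cv z j Y ψ‖ ≤ E₀ * Real.exp (-(κE * torusTreeLen Y.1))) →
        (∀ z ∈ O, ∀ (j : Fin (k + 1)) (Y : (domSys P M j).Dom), AnalyticOnNhd ℂ (cv z j Y) (spaceI Sg Rz M j (domSites P M j Y) cs.α₀ cs.α₁)) →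
        ∀ (Y : TDom P.d (L * domCount P M (k + 1))) (A : (𝔇.𝒦 Z t).Λ → ℝ), DifferentiableOn ℂ (fun z => 𝔇.realSliceOlder Oc Z t (cv z) ξ Y A) O)) :=
  ⟨olderLemma2_of_readsOnByC Sg Rz cs E₀ κE Z t Oc (h.mono Subset.rfl Subset.rfl (subset_univ _)) (hmaps.mono Subset.rfl (subset_univ _))
      (hhol.mono Subset.rfl (subset_univ _)) hjc.cfgCContinuous hC hE₀ hK hμ hm hμm,
    SliceInputsLGU.olderLaws_of_readsOnBy (𝔇.realSliceOlder Oc) Sg Rz cs E₀ κE Z t (h.realSlice fun _ _ => mem_univ _) hW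
      (hmaps.toReal fun _ _ => mem_univ _) (hholξ.toReal fun _ _ => mem_univ _) hjc.toReal hK hμ hloc.toReal⟩

/-! ## §3 The read pair: `𝒪 := readOlder (toReal ∘ Rc)`, `Oc := readOlderC Rc` -/

/-- **The same for the READ PAIR** — the older-terms potential literally read by a family of complex readings (`Oc := 𝔇.readOlderC Rc`, whose real slice IS `𝔇.readOlder (toReal ∘ Rc)`,
W1-17c `realSliceOlder_readOlderC`): all eight fields of the older-terms block of `SliceInputsL2U … (𝔇.readOlder fun Z t => (Rc Z t).toReal) …` at the slice `(Z, t)` from the laws of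
`Rc Z t` alone (`readsOnByC_readOlderC`). [cite: Balaban1988RG2Cluster, Lemma 1 (1.33) p.9 and Lemma 2 (1.41) p.11; Balaban1987RG1, (3.10) p.272] -/
theorem olderBlock_readOlderC (Rc : (Z : (domSys P M (k + 1)).Dom) → (t : TermLabel P M k L) → 𝔇.ReadingAtomsC Z t S) (hW : IsOpen W)
    (hmaps : (Rc Z t).MapsToTablesC (fun j X => spaceI Sg Rz M j (domSites P M j X) cs.α₀ cs.α₁) W univ) (hholξ : (Rc Z t).CfgCHoloOn W univ)
    (hhol : (Rc Z t).CfgFieldHoloOn W univ) (hjc : (Rc Z t).CfgCJointContinuous) (hC : 0 ≤ C) (hE₀ : 0 ≤ E₀) (hK : (Rc Z t).KernelBounded C) (hμ : (Rc Z t).FiniteMass mu)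
    (hm : ∀ Y j X, 0 ≤ m Y j X) (hμm : (Rc Z t).FiniteMassAt m) (hloc : (Rc Z t).LocalInC S₀) :
    ((∀ Y ∈ t.1, 0 ≤ TermDatum214.crudeBound C E₀ κE m Y) ∧
      (∀ old : OlderTerms P 𝔸 M k, old ∈ AdmHist (spaceOfRecord (M := M) Sg Rz (fun _ => cs.α₀) (fun _ => cs.α₁)) E₀ κE k → ∀ ξ ∈ W,
        ∀ (Y : TDom P.d (L * domCount P M (k + 1))) (A : (𝔇.𝒦 Z t).Λ → ℝ),
          𝔇.readOlder (fun Z t => (Rc Z t).toReal) Z t old ξ Y A = 𝔇.readOlderC Rc Z t old ξ Y (ofRealVec A)) ∧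
      (∀ old : OlderTerms P 𝔸 M k, old ∈ AdmHist (spaceOfRecord (M := M) Sg Rz (fun _ => cs.α₀) (fun _ => cs.α₁)) E₀ κE k → ∀ ξ ∈ W,
        ∀ Y : TDom P.d (L * domCount P M (k + 1)), DifferentiableOn ℂ (𝔇.readOlderC Rc Z t old ξ Y) (ball 0 RA)) ∧
      (∀ old : OlderTerms P 𝔸 M k, old ∈ AdmHist (spaceOfRecord (M := M) Sg Rz (fun _ => cs.α₀) (fun _ => cs.α₁)) E₀ κE k → ∀ ξ ∈ W,
        ∀ Y : TDom P.d (L * domCount P M (k + 1)), ∀ z ∈ ball (0 : (𝔇.𝒦 Z t).Λ → ℂ) RA, ‖𝔇.readOlderC Rc Z t old ξ Y z‖ ≤ TermDatum214.crudeBound C E₀ κE m Y)) ∧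
    ((∀ old : OlderTerms P 𝔸 M k, old ∈ AdmHist (spaceOfRecord (M := M) Sg Rz (fun _ => cs.α₀) (fun _ => cs.α₁)) E₀ κE k →
        ∀ ξ ∈ W, ∀ Y : TDom P.d (L * domCount P M (k + 1)), Measurable (𝔇.readOlder (fun Z t => (Rc Z t).toReal) Z t old ξ Y)) ∧
      (∀ old : OlderTerms P 𝔸 M k, old ∈ AdmHist (spaceOfRecord (M := M) Sg Rz (fun _ => cs.α₀) (fun _ => cs.α₁)) E₀ κE k →
        ∀ (Y : TDom P.d (L * domCount P M (k + 1))) (A : (𝔇.𝒦 Z t).Λ → ℝ),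
          DifferentiableOn ℂ (fun ξ : CPair P 𝔸 => 𝔇.readOlder (fun Z t => (Rc Z t).toReal) Z t old ξ Y A) W) ∧
      (∀ old : OlderTerms P 𝔸 M k, old ∈ AdmHist (spaceOfRecord (M := M) Sg Rz (fun _ => cs.α₀) (fun _ => cs.α₁)) E₀ κE k →
        ∀ ξ ∈ W, ∀ Y ∈ t.1, ∀ A A' : (𝔇.𝒦 Z t).Λ → ℝ, (∀ b ∈ S₀, A b = A' b) →
          𝔇.readOlder (fun Z t => (Rc Z t).toReal) Z t old ξ Y A = 𝔇.readOlder (fun Z t => (Rc Z t).toReal) Z t old ξ Y A') ∧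
      (∀ ξ ∈ W, ∀ (O : Set ℂ), IsOpen O → ∀ cv : ℂ → OlderTerms P 𝔸 M k,
        (∀ (j : Fin (k + 1)) (Y : (domSys P M j).Dom) (ψ : CPair P 𝔸), ψ ∈ spaceI Sg Rz M j (domSites P M j Y) cs.α₀ cs.α₁ →
          DifferentiableOn ℂ (fun z => cv z j Y ψ) O ∧ ∀ z ∈ O, ‖cv z j Y ψ‖ ≤ E₀ * Real.exp (-(κE * torusTreeLen Y.1))) →
        (∀ z ∈ O, ∀ (j : Fin (k + 1)) (Y : (domSys P M j).Dom), AnalyticOnNhd ℂ (cv z j Y) (spaceI Sg Rz M j (domSites P M j Y) cs.α₀ cs.α₁)) →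
        ∀ (Y : TDom P.d (L * domCount P M (k + 1))) (A : (𝔇.𝒦 Z t).Λ → ℝ), DifferentiableOn ℂ (fun z => 𝔇.readOlder (fun Z t => (Rc Z t).toReal) Z t (cv z) ξ Y A) O)) := by
  have h := olderBlock_of_readsOnByC (RA := RA) Sg Rz cs E₀ κE Z t (𝔇.readOlderC Rc) (TermDatum214.readsOnByC_readOlderC Rc Z t _ W univ) hW hmaps hholξ hhol hjc hC hE₀ hK hμ hm
    hμm hloc
  rw [TermDatum214.realSliceOlder_readOlderC] at h
  exact h

end SliceInputsL2U

end YMDAG.N22.W1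

end
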